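import Mathlib
import Summits.QuantumFields.YangMills.Theorems.ConvexGribovBodyContinuumLegGivenGapStubOsMatching
import Summits.QuantumFields.YangMills.Theorems.ConvexGribovBodyContinuumLegGivenGapCsclTorusForms
import Summits.QuantumFields.YangMills.Theorems.ConvexGribovBodyContinuumLegGivenGapStubCltOfCscl
import HarnessLib

/-!
# `ContinuumLegGivenGap` (stmt-QuantumFields-15828), line `Sketch`, reshape 18b: `stub_csclCoreVar` — per-datum matching at the scheme level (variance clause)

Support file for the crux item stmt-QuantumFields-15828 (registered glue stub `stub_csclCoreVar` of line `Sketch`, reshape 18b).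
**Statement.** For a scheme `sch`, a complex `n`-point test function `F` supported at ordered positive times in
`[δ, T₀]` with gaps `≥ δ` (`δ > 0`), and the (UUVB) clause of the scheme (the uniform plaquette-string bound,
eventually in `k`, for some `s, α, β'`), the norm of the canonical curvature distribution of `ΘF* ⊗ F` and the
norm of the honest OS pairing `𝒫₀^{(k)}(𝔛ₖF, 𝔛ₖF) = ∫ conj 𝔛ₖF(Θ₀Ũ) · 𝔛ₖF(τ₀Ũ) dμ_k` of its centred lattice
representative `𝔛ₖF` agree up to `ε`, eventually in `k`, for every `ε > 0`.

**Proof.** Conjunct (i) of the landed `stub_osMatching` with `H := F` (and `α` replaced by `max α 0 ≥ 0`, which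
only weakens the (UUVB) inequality) gives `K` with `‖𝓓_k(ΘF* ⊗ F) − 𝒫₀^{(k)}‖ ≤ a_k K` at every `k` at which the
(UUVB) inequality, `a_k < δ`, `a_k ≤ 1` and `T₀ + a_k ≤ a_k L_k` hold; all four hold eventually (`a_k → 0`,
`a_k L_k → ∞`), as does `a_k |K| ≤ ε`; the shift `τ₀ = configShift 0` is the identity and `2 L_k + 1 = side k`;
conclude by `|‖u‖ − ‖v‖| ≤ ‖u − v‖`. No definitions, no facts; Mathlib + landed tree lemmas only. [folklore]
-/

noncomputable section

namespace Summit.QuantumFields.YangMills.Theorems.ContinuumLegGivenGap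

open scoped SchwartzMap ComplexConjugate
open Filter Topology MeasureTheory
open Literature.MathematicalPhysics.QuantumFieldTheory Literature.MathematicalPhysics.QuantumLattice
  Literature.MathematicalPhysics.AQFT Literature.Probability.LatticeModels
open Summit.QuantumFields.YangMills.Cruxes.ContinuumLimitOnTrajectory.TwoOrbitSynchronisation (curvDistribution)

/-- `stub_csclCoreVar` — **per-datum matching at the scheme level, variance clause** (registered stub of
stmt-QuantumFields-15828, line `Sketch`, reshape 18b): under the (UUVB) clause of the scheme, for `F` supported at
ordered positive times in `[δ, T₀]` with gaps `≥ δ`, the norms of the canonical curvature distribution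
`𝓓_k(ΘF* ⊗ F)` and of the OS pairing `∫ conj 𝔛ₖF(Θ₀Ũ) · 𝔛ₖF(τ₀Ũ) dμ_k` of the centred lattice representative
differ by at most `ε` eventually in `k` (conjunct (i) of `stub_osMatching` with `H := F`, the side conditions
holding eventually along the scheme, and the reverse triangle inequality). [folklore] -/
theorem stub_csclCoreVar :
    ∀ (G : Type) [Group G] [TopologicalSpace G] [IsTopologicalGroup G] [CompactSpace G]
      [MeasurableSpace G] [BorelSpace G] (r : LatticeRep G) (sch : SpeciesScheme (YMSpecies G)) (n : ℕ)
      (F : SchwartzMap (Fin n → EuclideanSpace ℝ (Fin 4)) ℂ) (δ T₀ : ℝ), 0 < δ →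
      tsupport (F : (Fin n → EuclideanSpace ℝ (Fin 4)) → ℂ) ⊆
        {x | (∀ i, δ ≤ x i 0 ∧ x i 0 ≤ T₀) ∧ ∀ i i', i < i' → x i 0 + δ ≤ x i' 0} →
      (∃ (s : ℕ) (α β' : ℝ), ∀ᶠ k in atTop, ∀ (p : ℕ) (q : Fin p → {q : Fin 4 × Fin 4 // q.1 < q.2})
        (Fx : SchwartzMap (Fin p → EuclideanSpace ℝ (Fin 4)) ℂ), IsOffDiagonal Fx →
        ‖∫ U : GaugeConfig 4 (sch.side k) G, ∑ x : Fin p → ↥(box 4 (sch.L k)),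
            Fx (fun i => sch.a k • siteToE ↑(x i)) *
              ∏ i, ((plaquetteObs r.ρ 0 (q i).1.1 (q i).1.2 (configShift (-↑(x i)) (torusLift (sch.side k) U)) -
                wilsonTorusMean r.ρ (sch.β k) (sch.L k) (plaquetteObs r.ρ 0 (q i).1.1 (q i).1.2) : ℝ) : ℂ)
            ∂(wilsonMeasure r.ρ (sch.β k))‖ ≤ α * (p.factorial : ℝ) ^ β' * schwartzNorm (p * s) Fx) →
      ∀ ε : ℝ, 0 < ε → ∀ᶠ k : ℕ in atTop,
        |‖curvDistribution r sch k (n + n) ((osAdjoint F).appendTensor F)‖ -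
          ‖∫ U : GaugeConfig 4 (2 * sch.L k + 1) G, (starRingEnd ℂ) ((fun V => ∑ x : Fin n → ↥(box 4 (sch.L k)), F (fun i => sch.a k • siteToE ↑(x i)) * ∏ i, ((r.curvature.F (configShift (-↑(x i)) V) - wilsonTorusMean r.ρ (sch.β k) (sch.L k) r.curvature.F : ℝ) : ℂ)) (cfgReflect (torusLift (2 * sch.L k + 1) U))) * (fun V => ∑ x : Fin n → ↥(box 4 (sch.L k)), F (fun i => sch.a k • siteToE ↑(x i)) * ∏ i, ((r.curvature.F (configShift (-↑(x i)) V) - wilsonTorusMean r.ρ (sch.β k) (sch.L k) r.curvature.F : ℝ) : ℂ)) (configShift (-(Pi.single 0 ((0 : ℕ) : ℤ))) (torusLift (2 * sch.L k + 1) U)) ∂(wilsonMeasure r.ρ (sch.β k))‖| ≤ ε := by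
  intro G _ _ _ _ _ _ r sch n F δ T₀ hδ hF hU ε hε
  obtain ⟨s, α, β', hev⟩ := hU
  obtain ⟨K, hK⟩ :=
    (stub_osMatching G r sch).1 s (max α 0) β' n n F F δ T₀ hδ (le_max_right α 0) hF hF
  -- the extra shift `τ₀ = configShift (-(e₀ · 0)) = configShift 0` is the identity
  have h0 : ∀ V : LGConfig 4 G, configShift (-(Pi.single 0 ((0 : ℕ) : ℤ))) V = V := fun V => by
    ext e
    simp
  -- the side conditions of `stub_osMatching` hold eventually along the scheme
  have ha : ∀ᶠ k : ℕ in atTop, sch.a k < δ := sch.tendsto_a.eventually (eventually_lt_nhds hδ)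
  have ha1 : ∀ᶠ k : ℕ in atTop, sch.a k ≤ 1 := sch.tendsto_a.eventually (eventually_le_nhds one_pos)
  have hT : ∀ᶠ k : ℕ in atTop, T₀ + 1 ≤ sch.a k * sch.L k :=
    sch.tendsto_L.eventually (eventually_ge_atTop _)
  have hKε : ∀ᶠ k : ℕ in atTop, sch.a k * |K| ≤ ε := by
    have h : Tendsto (fun k => sch.a k * |K|) atTop (𝓝 (0 * |K|)) := sch.tendsto_a.mul_const _
    rw [zero_mul] at h
    exact h.eventually (eventually_le_nhds hε)
  filter_upwards [hev, ha, ha1, hT, hKε] with k hUk hak ha1k hTk hKk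
  -- the (UUVB) inequality with `α` implies the one with `max α 0`
  have hb := hK k (fun p q Fx hFx => (hUk p q Fx hFx).trans
    (mul_le_mul_of_nonneg_right (mul_le_mul_of_nonneg_right (le_max_left α 0)
      (Real.rpow_nonneg (Nat.cast_nonneg _) _)) (schwartzNorm_nonneg _ _))) hak ha1k (by linarith)
  simp only [h0]
  refine (abs_norm_sub_norm_le _ _).trans (hb.trans ?_)
  exact (mul_le_mul_of_nonneg_left (le_abs_self K) (sch.a_pos k).le).trans hKk

end Summit.QuantumFields.YangMills.Theorems.ContinuumLegGivenGap

end
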